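import Summits.QuantumFields.BalabanUV.T4Continuum.Support.OutputRateFunctionalTablesTermwise

/-!
# OutputRateFunctionalTablesTermwiseWitness — NON-VACUITY of Road D's termwise END: the kernel's no-room termwise toy READ AS
# CONSTANT FAMILIES over the one-point chart fires `FamilySlots.ne5_of_familySlots_termwise`, and the transfer returns the
# kernel's landed statement `toyE_ne5_termwise_slack` over the ORIGINAL toy carriers (sibling of part 4
# `OutputRateFunctionalTablesTermwise`; NE5 crux O1, owner R48-F ∕ R49; cell `pub-balaban`, T⁴ fan-out; `HOME/CLAIMS.log` INTENT l.17175)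

Unit `b2b-balaban-t4-ne5-formalise-leaf-02` (NE5 formalisation swarm, leaf prover 02, gen 17).  Summits-side NEW WORK under the
LEAN PLACEMENT RULE (a TOY on the cell's own kernel; NOT a Literature module; nothing printed is asserted; no `[cite:]` tag; no
`Prop`-valued fact; the two `def`s are DATA).  HONEST FRAMING: rung (B)+1 of the FINITE-VOLUME T⁴ continuum programme — NOT
infinite volume, NOT a mass gap, NOT the Clay problem, NOT a proof of NE5 (NOT PRINTED; cell GAPS G-t4-U3-1).  HONEST DEPENDENCY
(cell line, verbatim): continuum YM on T⁴ ⇐ BetaPertH ∧ nine spine estimates (0/9 proved); BetaPertH ⇐ (D1) ∧ (D4) ∧ CAP+tail;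
G-an2-4 gates asym, D1 and NE2/3/4.

WHAT ([folklore]; NO estimate, nothing about Bałaban's functionals).  `toySlotsE : FamilySlots toyCarriers Unit ℂ ℂ` = the
kernel's regauged termwise toy `T4InputCauchyRateTermwise.toyModelER` (output `exp(o + h) − 1`, operator data `(1/2)^k` vs `0`,
the history feed "read the previous scale with gain `1/64`", base class `{o = 0, ‖h‖ ≤ 1}`, margins `(1/8, 1)`) with every
operator ∕ inserted datum read as a CONSTANT background family (`constFam`) and the admissible class read coordinatewise.  Then
EVERY binder of part 4's `FamilySlots.ne5_of_familySlots_termwise` is met — representation of the lifts and admissibility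
(definitionally the kernel's `toyE_representsA` ∕ `toyE_representsB` ∕ `toyE_inBase`), the pointwise slack into the pointwise
ball class of radii `(1/8, 2)` (the kernel's `boxInClass_of_baseBudget` on `toyE_baseBudget` with the plain room inequalities),
the pointwise termwise data (`toyE₁_termRep` ∕ `toyE₁_termBound` ∕ `toyE₁_termBudget` ∕ `toyE₁_termLineAnalytic`: the Taylor
terms `(o + h)^{i+1}/(i+1)!`, factorial majorants, class constant `9`), the decay levels `2 + 3`, the pointwise rates
(`toyER_operatorRate`, `toyER_insertionRate`), the structure of the family insertion (part 2 `insAffine_of_pointwise`, part 4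
`insBlind_of_pointwise` ∕ `insHomog_of_pointwise` on the kernel's `toy_insAffine` ∕ `toy_insBlind` ∕ `toy_insHomog`), the
pointwise single-scale bound (`toyER_insScaleBound`), and the kernel's numerics (reach `1/3` from `k₀ = 5`, `B = 80`,
smallness `1/64 + (9/(1 − 1/3))/64 = 29/128 < 1/2`) — and the END returns, through part 1's `ne5_of_ne5_lift` inside it, EXACTLY
the statement of the kernel's landed `toyE_ne5_termwise_slack` over the ORIGINAL toy carriers (an `example`: the statement is
the kernel's, not re-declared).  The named theorems record that each family-model shape fires on the toy (`TermRep`,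
`TermBound`, `TermLineAnalytic`, `BoxInClass`, the structure binders, `InsScaleBound`).  0 sorry; axioms ⊆ {propext,
Classical.choice, Quot.sound}.
-/

noncomputable section

open scoped BigOperators ENNReal
open Finset Function Metric Set

namespace Summit.QuantumFields.BalabanUV.T4Continuum.OutputRateFunctionalTablesTermwiseWitness

open Literature.MathematicalPhysics.QuantumFieldTheory.Balaban1983to89
open Literature.MathematicalPhysics.QuantumFieldTheory.Balaban1983to89.T4OutputRate
open Literature.MathematicalPhysics.QuantumFieldTheory.Balaban1983to89.T4InputCauchyRate (toyCarriers toyEB)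
open Literature.MathematicalPhysics.QuantumFieldTheory.Balaban1983to89.T4InputCauchyRateData
open Literature.MathematicalPhysics.QuantumFieldTheory.Balaban1983to89.T4InputCauchyRateSpecies
open Literature.MathematicalPhysics.QuantumFieldTheory.Balaban1983to89.T4InputCauchyRateTermwise
open Summit.QuantumFields.BalabanUV.T4Continuum.OutputRateFunctionalTables
open Summit.QuantumFields.BalabanUV.T4Continuum.OutputRateFunctionalTablesFamily
open Summit.QuantumFields.BalabanUV.T4Continuum.OutputRateFunctionalTablesTermwise

/-! ## §1 Constant background families and the toy's family slots -/

/-- [folklore] DATA: the CONSTANT background family with value `x` (bounded by `‖x‖`, hence an `ℓ^∞` family). -/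
def constFam {𝒰 : Type} {E : Type*} [NormedAddCommGroup E] (x : E) : Fam 𝒰 E :=
  ⟨fun _ => x, memℓp_infty ⟨‖x‖, by rintro _ ⟨u, rfl⟩; exact le_rfl⟩⟩

/-- [folklore] A constant family, evaluated. -/
@[simp] theorem constFam_apply {𝒰 : Type} {E : Type*} [NormedAddCommGroup E] (x : E) (u : 𝒰) :
    constFam (𝒰 := 𝒰) x u = x := rfl

/-- [folklore] DATA: THE KERNEL's NO-ROOM TERMWISE TOY AS FAMILY SLOTS over the one-point chart — output `exp(o + h) − 1` at the
first component, the two runs' operator data and insertions (tables curried back along `n ↦ (n, ())`) as CONSTANT families, a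
family pair admissible iff admissible coordinatewise, margins `(1/8, 1)` of `toyModelER`. -/
def toySlotsE : FamilySlots toyCarriers Unit ℂ ℂ where
  Out k o h p := toyModelER.Out k o h p.1
  opA g k := constFam (toyModelER.opA g () k)
  opB g k := constFam (toyModelER.opB g () k)
  insA g k t := constFam (toyModelER.insA g () k fun n => t (n, ()))
  insB g k t := constFam (toyModelER.insB g () k fun n => t (n, ()))
  Base k g := {p | ∀ u, (p.1 u, p.2 u) ∈ toyModelER.Base k g ()}
  rOp := toyModelER.rOp
  rHist := toyModelER.rHist
  rOp_pos := toyModelER.rOp_pos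
  rHist_pos := toyModelER.rHist_pos

/-- [folklore] DATA-FREE ABBREVIATIONS are avoided: the pointwise class is the kernel's ball class of radii `(1/8, 2)` at the
one background, the pointwise term family the kernel's Taylor terms read at the first component (both written in full below). -/
theorem toySlotsE_out (k : ℕ) (o h : ℂ) (p : ℕ × Unit) :
    toySlotsE.Out k o h p = Complex.exp (o + h) - 1 := rfl

/-! ## §2 Every binder of the termwise END fires on the toy -/

/-- [folklore] Run A's lift is represented (the kernel's `toyE_representsA`, definitionally). -/
theorem toySlotsE_representsA : toySlotsE.toStepModel.RepresentsA (liftA id toyEAE) Set.univ :=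
  fun g hg _ p => toyE_representsA g hg p.2 p.1

/-- [folklore] Run B's lift is represented (the kernel's `toyE_representsB`, definitionally). -/
theorem toySlotsE_representsB : toySlotsE.toStepModel.RepresentsB (liftB id toyEB) Set.univ :=
  fun g hg _ p => toyE_representsB g hg p.2 p.1

/-- [folklore] Run B's family data are admissible (the kernel's `toyE_inBase` at the one coordinate). -/
theorem toySlotsE_inBase : toySlotsE.toStepModel.InBase (liftB id toyEB) Set.univ :=
  fun k g hg _ _ => toyE_inBase k g hg ()

/-- [folklore] THE POINTWISE SLACK: the pointwise two-margin box around every admissible coordinate lies in the pointwise ball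
class of radii `(1/8, 2)` — the kernel's `boxInClass_of_baseBudget` on `toyE_baseBudget` with the plain room inequalities
`0 + 1/8 ≤ 1/8`, `1 + 1 ≤ 2`. -/
theorem toySlotsE_box : ∀ k, ∀ g ∈ (Set.univ : Set (ℕ → ℝ)), ∀ p ∈ toySlotsE.Base k g, ∀ u : Unit,
    closedBall (p.1 u) (toySlotsE.rOp k) ×ˢ closedBall (p.2 u) (toySlotsE.rHist k) ⊆
      ballClass toyCtr (fun _ => 1 / 8) (fun _ => 2) k g () := by
  intro k g hg p hp u
  have hK : BoxInClass toyModelER (ballClass toyCtr (fun _ => 1 / 8) fun _ => 2) Set.univ :=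
    boxInClass_of_baseBudget (M := toyModelER) (BOp := fun _ => 0) (BHist := fun _ => 1) toyE_baseBudget
      (fun k => by show (0 : ℝ) + 1 / 8 * 1 ≤ 1 / 8; norm_num) (fun k => by show (1 : ℝ) + 1 * 1 ≤ 2; norm_num)
  exact hK k g hg () (p.1 u, p.2 u) (hp u)

/-- [folklore] `BoxInClass` of the toy's FAMILY model into the family class (part 4's `boxInClass_of_pointwise` fires). -/
theorem toySlotsE_boxInClass :
    BoxInClass toySlotsE.toStepModel (famClass fun k g (_ : Unit) => ballClass toyCtr (fun _ => 1 / 8) (fun _ => 2) k g ())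
      Set.univ :=
  FamilySlots.boxInClass_of_pointwise toySlotsE toySlotsE_box

/-- [folklore] `TermRep` of the family model by the family Taylor terms (part 4's `termRep_of_pointwise` on `toyE₁_termRep`). -/
theorem toySlotsE_termRep :
    TermRep toySlotsE.toStepModel (famClass fun k g (_ : Unit) => ballClass toyCtr (fun _ => 1 / 8) (fun _ => 2) k g ())
      (famTerm fun k i o h (p : ℕ × Unit) => toyTermE k i o h p.1) Set.univ :=
  FamilySlots.termRep_of_pointwise toySlotsE fun k g hg _ q hq X hX => toyE₁_termRep k g hg () q hq X hX

/-- [folklore] `TermBound` with the factorial majorants `toyMajE₁` (part 4's `termBound_of_pointwise` on `toyE₁_termBound`). -/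
theorem toySlotsE_termBound :
    TermBound (famClass (C := toyCarriers) fun k g (_ : Unit) => ballClass toyCtr (fun _ => 1 / 8) (fun _ => 2) k g ())
      (famTerm fun k i o h (p : ℕ × Unit) => toyTermE k i o h p.1) Set.univ 0 toyMajE₁ :=
  FamilySlots.termBound_of_pointwise (𝒰 := Unit) fun k g hg _ q hq X hX i => toyE₁_termBound k g hg () q hq X hX i

/-- [folklore] `TermLineAnalytic` of the family terms (part 4's `termLineAnalytic_of_pointwise` on `toyE₁_termLineAnalytic`). -/
theorem toySlotsE_termLineAnalytic :
    TermLineAnalytic (famClass (C := toyCarriers) fun k g (_ : Unit) => ballClass toyCtr (fun _ => 1 / 8) (fun _ => 2) k g ())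
      (famTerm fun k i o h (p : ℕ × Unit) => toyTermE k i o h p.1) Set.univ :=
  FamilySlots.termLineAnalytic_of_pointwise (𝒰 := Unit) fun k g hg _ o u h v hseg X hX i =>
    toyE₁_termLineAnalytic k g hg () o u h v hseg X hX i

/-- [folklore] The family insertion is affine (part 2's `insAffine_of_pointwise` on the kernel's `toy_insAffine`). -/
theorem toySlotsE_insAffine : toySlotsE.toStepModel.InsAffine Set.univ :=
  toySlotsE.insAffine_of_pointwise fun k g hg t t' _ => toy_insAffine k g hg () (fun n => t (n, ())) fun n => t' (n, ())

/-- [folklore] The family insertion is blind to scales `≥ k` (part 4's `insBlind_of_pointwise` on `toy_insBlind`). -/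
theorem toySlotsE_insBlind : toySlotsE.toStepModel.InsBlind Set.univ :=
  FamilySlots.insBlind_of_pointwise toySlotsE fun k g hg t t' htt' _ =>
    toy_insBlind k g hg () (fun n => t (n, ())) (fun n => t' (n, ())) fun Y hY => htt' Y hY ()

/-- [folklore] The family insertion's table-driven part is real-homogeneous (part 4's `insHomog_of_pointwise` on `toy_insHomog`). -/
theorem toySlotsE_insHomog : toySlotsE.toStepModel.InsHomog Set.univ :=
  FamilySlots.insHomog_of_pointwise toySlotsE fun k g hg a t _ => toy_insHomog k g hg () a fun n => t (n, ())

/-- [folklore] The single-scale bound at level `3`, gain `1/64`, damping `1/64` (part 4's `insScaleBound_of_pointwise` on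
`toyER_insScaleBound`). -/
theorem toySlotsE_insScaleBound : toySlotsE.toStepModel.InsScaleBound Set.univ 0 3 (1 / 64) (1 / 64) :=
  FamilySlots.insScaleBound_of_pointwise toySlotsE fun k g hg t j hj hs hb _ =>
    toyER_insScaleBound (by norm_num) k g hg () (fun n => t (n, ())) j hj (fun Y hY => hs Y () hY) fun Y hY => hb Y hY ()

/-! ## §3 The END fires and returns the kernel's landed toy statement over the ORIGINAL carriers -/

/-- [folklore] **ROAD D's TERMWISE END FIRES ON THE TOY AND RETURNS THE KERNEL's `toyE_ne5_termwise_slack` STATEMENT** (an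
`example`: the statement over the original toy carriers is the kernel's landed one, here reached through the family model over
`paramCarriers toyCarriers Unit` and part 1's transfer — every one of the END's binders is jointly satisfiable on a model whose
output is an honest convergent expansion, and the conclusion is a genuine rate `1/2`). -/
example : NE5 toyEAE toyEB (Set.univ : Set (ℕ → ℝ)) 0 (1 / 2)
    ((9 / (1 - 1 / 3) * 8 + 9 / (1 - 1 / 3) * 0 + 80) * (1 / 2 - 1 / 64) /
      (1 / 2 - (1 / 64 + 9 / (1 - 1 / 3) * (1 / 64)))) :=
  FamilySlots.ne5_of_familySlots_termwise toySlotsE surjective_id (ρ := id) (W := Set.univ)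
    (K := fun k g (_ : Unit) => ballClass toyCtr (fun _ => 1 / 8) (fun _ => 2) k g ())
    (T := fun k i o h (p : ℕ × Unit) => toyTermE k i o h p.1) (a := toyMajE₁) (EA₀ := 2) (E₀ := 3) (E₁ := 3) (δ := 8)
    (δ' := 0) (θ := 1 / 2) (c := 1 / 64) (ω := 1 / 64) (ρ₀ := 1 / 3) (B := 80) (k₀ := 5)
    toySlotsE_representsA toySlotsE_representsB toySlotsE_inBase toySlotsE_box
    (fun k g hg _ q hq X hX => toyE₁_termRep k g hg () q hq X hX)
    (fun k g hg _ q hq X hX i => toyE₁_termBound k g hg () q hq X hX i) toyE₁_termBudget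
    (fun k g hg _ o u h v hseg X hX i => toyE₁_termLineAnalytic k g hg () o u h v hseg X hX i) toyE_decayA toy_decayB
    (fun k g hg _ => toyER_operatorRate k g hg ())
    (fun k g hg t ht _ => toyER_insertionRate k g hg () (fun n => t (n, ())) fun n => ht n ())
    toySlotsE_insAffine toySlotsE_insBlind toySlotsE_insHomog
    (fun k g hg t j hj hs hb _ =>
      toyER_insScaleBound (by norm_num) k g hg () (fun n => t (n, ())) j hj (fun Y hY => hs Y () hY) fun Y hY => hb Y hY ())
    (by norm_num) (by norm_num) (by norm_num) le_rfl (by norm_num) le_rfl (by norm_num) (by norm_num) (by norm_num)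
    (by norm_num) (by norm_num) (by norm_num)
    (fun k hk => by
      have hk' : k ≤ 4 := by omega
      calc (2 : ℝ) + 3 = 80 * (1 / 2) ^ 4 := by norm_num
        _ ≤ 80 * (1 / 2) ^ k := by
          apply mul_le_mul_of_nonneg_left _ (by norm_num)
          exact pow_le_pow_of_le_one (by norm_num) (by norm_num) hk')
    (by norm_num)

/-- [folklore] NE5 OF THE LIFTS over `paramCarriers toyCarriers Unit` at the same rate and constant (the kernel's END over the
re-indexed carriers BEFORE the transfer — a statement about the family road, recorded as a theorem). -/
theorem toySlotsE_ne5_lift : NE5 (liftA id toyEAE) (liftB id toyEB) (Set.univ : Set (ℕ → ℝ)) 0 (1 / 2)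
    ((9 / (1 - 1 / 3) * 8 + 9 / (1 - 1 / 3) * 0 + 80) * (1 / 2 - 1 / 64) /
      (1 / 2 - (1 / 64 + 9 / (1 - 1 / 3) * (1 / 64)))) :=
  ne5_at_of_stepModel_termwise_slack_scale_nat toySlotsE.toStepModel
    (famClass fun k g (_ : Unit) => ballClass toyCtr (fun _ => 1 / 8) (fun _ => 2) k g ())
    (famTerm fun k i o h (p : ℕ × Unit) => toyTermE k i o h p.1) (ρ₀ := 1 / 3) (B := 80) (k₀ := 5)
    toySlotsE_representsA toySlotsE_representsB toySlotsE_inBase toySlotsE_boxInClass toySlotsE_termRep toySlotsE_termBound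
    toyE₁_termBudget toySlotsE_termLineAnalytic (decayBound_liftA_of id toyE_decayA) (decayBound_liftB_of id toy_decayB)
    ((toySlotsE.operatorRate_iff_pointwise Set.univ 8 (1 / 2)).2 fun k g hg _ => toyER_operatorRate k g hg ())
    (toySlotsE.insertionRate_of_pointwise fun k g hg t ht _ =>
      toyER_insertionRate k g hg () (fun n => t (n, ())) fun n => ht n ())
    toySlotsE_insAffine toySlotsE_insBlind toySlotsE_insHomog toySlotsE_insScaleBound (by norm_num) (by norm_num)
    (by norm_num) le_rfl (by norm_num) le_rfl (by norm_num) (by norm_num) (by norm_num) (by norm_num) (by norm_num)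
    (by norm_num)
    (fun k hk => by
      have hk' : k ≤ 4 := by omega
      calc (2 : ℝ) + 3 = 80 * (1 / 2) ^ 4 := by norm_num
        _ ≤ 80 * (1 / 2) ^ k := by
          apply mul_le_mul_of_nonneg_left _ (by norm_num)
          exact pow_le_pow_of_le_one (by norm_num) (by norm_num) hk')
    (by norm_num)

end Summit.QuantumFields.BalabanUV.T4Continuum.OutputRateFunctionalTablesTermwiseWitness

end
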